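import Summits.QuantumFields.YangMills.Theorems.BalabanLadderIRPinnedExitCofinal
import Summits.QuantumFields.YangMills.Theorems.BalabanLadderIRRankPurityCofinalDefs
import Summits.QuantumFields.YangMills.Theorems.BalabanLadderIRTwistCostOfPurity
import Summits.QuantumFields.YangMills.Theses.BalabanLadder
import Literature.MathematicalPhysics.QuantumFieldTheory.TomboulisConfinementClaim
import Literature.Barriers.QuantumFields.MigdalKadanoffGroupBlindness
import HarnessLib

/-!
# Crux `IRcof` (stmt-QuantumFields-26930) ∕ supplier token PX of `IR` (stmt-QuantumFields-19354) — LINE «tuned-mk-sandwich»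
# (ideator ym-ir-idea-19 gen 0, lens `nearmiss`, LINE 2: the single input of LINE 1's measured deficit CHANGED — the decimation)

HONEST LABEL.  Nothing here proves the Yang–Mills mass gap (Clay), `IRcof`, `IR`, `PinnedExitAt (1/24)`, confinement, or the
existence of a single pure box; `R4` closes only the conditional finite-𝕋⁴ rung `BalabanLadder.UV`; R2c stays IDEA-BOUND; nothing
continuum ∕ OS ∕ Clay is touched.  The three `stub_*` below carry ALL the content; everything else is bookkeeping PROVED here.
MC ∕ flow-velocity numbers are GUIDANCE, never proof terms.

WHAT DIED IN LINE 1 (`mk_lag_sandwich.lean`, crit-3 17:20:39Z STRIKE-for-cause, §K MK-VELOCITY WALL): the Migdal–Kadanoff (`b = 2`,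
`ζ = b^{d−2} = 4`, `r = 1`) chain is a Jensen UPPER bound on `Z` whose one-loop velocity is `R(b) = π²(1−b⁻²)/(11 ln b)` of asymptotic
freedom's (`R(2) = 0.9708`, MK's decrement is EXACTLY `1/4 β_W` per octave vs `8b₀ln2 = 0.2575`), so a FIXED pin `a(β)·L ≤ T` is
outrun by `0.106 β_W` octaves: `MKBoundedLag` is guidance-false; no integer `b`, no `r ≤ 1`, no `ζ₀ < b^{d−2}` (not a bound, Tomboulis
p. 7) and no anisotropic split repairs it INSIDE the uniform-moving class.

THE CHANGED INPUT (this line): NON-UNIFORM potential moving.  Of the four in-plane tiles of a coarse plaquette give two the moved strength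
`(4+ε)β` and two `(4−ε)β`.  The translation-average is still `β` per plaquette, so convexity of `ln Z` (Kadanoff's 1975 variational
bond-moving principle; Tomboulis App. A) gives the SAME upper-bound property as MK for every `ε`; but at TREE level the decimated coupling
is `1/β' = Σᵢ 1/(ζᵢβ)`, i.e. `β' = β(1 − ε²/16)`: a CLASSICAL speed-up `ε²β/16` per octave from a vanishing non-uniformity.  The
schedule `ε_n² = κ₁/β_n − κ₂/β_n²` (`β_n = β − n/4`, clipped to `[0,1]`, OFF for `β_n ≤ κ₂/κ₁`) with `κ₁ = 16(8b₀ln2 − 1/4)`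
(`= 0.1203` for SU(2)) cancels the one-loop deficit and `κ₂` the residual two-loop log-drift (sign and size to be fitted from `β_W ≳ 10`
asymptotics; on `β_W ≤ 6` MK's excess over `1/4` is dominated by `O(β⁻²)` terms); the three-loop remainder is summable over octaves, so
the lag is BOUNDED.  Numerics (this session, Bessel-exact characters): at `β_W = 4` (`J = 40`), `κ₁ = 0.109` raises the per-octave
decrement from `0.2709` to `0.2769` (`+0.0060`; tree-level prediction `κ₁/16 = 0.0068`); at `β_W = 6` (`J = 48`) the one-loop-tuned chain
(`κ₁ = 0.1203`, `κ₂ = 0`) tracks the AF TWO-loop target `0.2575 + 0.0403/β` within `|Δ| ≤ 0.003`/octave on `β_eff ∈ [4.5, 6.1]`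
(plain MK: `−0.007`), over-speeding below `β_eff ≈ 4.5` (where `κ₂ > 0` switches the schedule off).
On the E2-Q3 window (`β_W ≤ 2.7`) the schedule is OFF (`ε = 0`): there the chain IS LINE 1's MK chain and its table T1 applies verbatim.

VELOCITY PINCER (barrier note, this line): a twist MINORANT forces the coarse flow to be no faster than the truth asymptotically
(`R ≤ 1`: else the coarse model reaches strong coupling at `ξ^{1/R} ≪ S_K ξ` and its cost `exp(−C S² ξ^{2(1−1/R)})` undercuts the
truth's `exp(−c S²)` on every non-femto box); a BOUNDED LAG forces `R ≥ 1`.  Hence only decimations with EXACT one- and two-loop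
velocity can serve ANY sandwich of this architecture — a two-parameter TUNING CONDITION (met here by `(κ₁, κ₂)`), not a wall; closed-form
uniform recursions (MK, integer `b`) are excluded, which is LINE 1's death restated as a theorem-shaped constraint.

* `TunedSandwich`   (crux K_tuned, rank 2): ∃ schedule `(κ₁, κ₂)`, floor multiple `S_K`, lag `k₀`, threshold `β_K` with BOTH the
  minorant on non-femto fine boxes `(8·2ⁿ)³ × (t·2ⁿ)`, `t ∈ {2,4}`, against the tuned-decimated weight on `8³ × t`, AND the bounded lag
  (tuned weight within `10⁻³` of `1` once `2^{k₀} ≤ a(β)·2ⁿ` — inside the PROVED double-exponential SC basin of the `r = 1` recursion,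
  Tomboulis App. D).  One ∃-crux because the two halves must share the schedule.
* `SCTwistBound`    (support S_sc — as LINE 1; Münster 1981 ∕ Ito–Seiler 2008 Thm 2.2 (1) for sup-small weights on `8³ × 2`, `8³ × 4`).
* `VacuumPurityCorridor` (residual V — as LINE 1 ∕ row 21: the `e = 0`-sector gap half of purity; no twist observable sees it).

COMPOSITION (PROVED, §4): K_tuned ∧ S_sc ∧ V ⇒ `PinnedExit96.PinnedExitAt (1/24)` (19354's token PX, BY NAME) ⇒ `PXcof24` = VERBATIM
the 26930 slot token `PinnedCofinalBill.PinnedExitsCofinalAt (1/24)` (via the landed `PinnedExitCofinal.pinnedExitsCofinal_of_pinnedExitAt`)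
⇒ with the slot's residual `IRnscCof`, `Theses.BalabanLadder.IRcof` BY NAME (`IRcof_of`).  Pin `T = 16·max(2^{k₀}, S/8, S_K/8)`.

DISPROOF ∕ NEGATIVES HONOURED: coupling-first quantifiers (`not_uniformExit24_holds`, p624174); the floor `LowerBounds G r a` is CONSUMED
(floor-free pinned exit is false); simply-connected simple `G` only (`U(1)₄` analogue FALSE — `MigdalKadanoffGroupBlindness` evasion (a):
the group enters through `b₀(G)` in the tuning `κ₁` and through the lag); femto fine boxes excluded from the minorant (one-loop coin flip,
p621160 mechanics).  DEDUP: §2 seams are row 21's (idea-10 `flux_purity_split.lean` §2) re-spelled — NOT new; `wilsonPlaqWeight`,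
`haarConv*`, `mkStep`, `mkIter`, `twistCost*`, `SCTwistBound`, `VacuumPurityCorridor` are LINE 1's decls repeated verbatim (Lines files are
not importable build targets); NEW here: `tunedStep`, `tuneEps`, `tunedIter`, `TunedSandwich`.
-/

set_option autoImplicit false

noncomputable section

open Filter Topology MeasureTheory
open Literature.MathematicalPhysics.QuantumFieldTheory Literature.MathematicalPhysics.QuantumLattice
open Summit.QuantumFields.YangMills.Cruxes.OSLegsFromFemtoAndGap.DlrCollarTransfer (LowerBounds)
open Summit.QuantumFields.YangMills.Cruxes.IR.ColdPurityBridge (coldDefect)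
open Summit.QuantumFields.YangMills.Cruxes.IR.RankPurity (IRnscCof)
open Summit.QuantumFields.YangMills.Cruxes.IR.PinnedExit96 (PinnedExitAt)
open Summit.QuantumFields.YangMills.Cruxes.IR.PinnedExitCofinal (cofinalGapOn_of_pinnedExits pinnedExitsCofinal_of_pinnedExitAt)
open Summit.QuantumFields.YangMills.Cruxes.IR.TwistCost (twistedPartition_le)

namespace Summit.QuantumFields.YangMills.Cruxes.IRcof.TunedMKSandwich

/-! ## §0 The Migdal–Kadanoff potential-moving recursion for a general compact group (definitions) -/

section Defs

variable {G : Type} [Group G] [TopologicalSpace G] [MeasurableSpace G]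

/-- Wilson's one-plaquette Boltzmann weight in the tree's normalisation: `exp (−β (N − Re tr ρ U))`, so that the product over the
plaquettes of a box is the integrand of `wilsonFinTorusPartition`. -/
def wilsonPlaqWeight {N : ℕ} (ρ : G →* Matrix (Fin N) (Fin N) ℂ) (β : ℝ) : G → ℝ :=
  fun U => Real.exp (-β * ((N : ℝ) - (ρ U).trace.re))

variable [IsTopologicalGroup G] [CompactSpace G] [BorelSpace G]

/-- Haar convolution of two real functions on `G`: `(g ⋆ h)(U) = ∫ g(V) h(V⁻¹U) dV`. -/
def haarConv (g h : G → ℝ) : G → ℝ := fun U => ∫ V, g V * h (V⁻¹ * U) ∂haarProbability G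

/-- `(k+1)`-fold Haar convolution power `g^{⋆(k+1)}`. -/
def haarConvPow (g : G → ℝ) : ℕ → G → ℝ
  | 0 => g
  | k + 1 => haarConv g (haarConvPow g k)

/-- ONE Migdal–Kadanoff potential-moving step, scale factor `b = 2`, `d = 4`, decimation parameter `r = 1`, normalised at the
identity: strengthen the plaquette weight `w ↦ w^{b^{d−2}} = w⁴` (move the `b²−…` interior plaquettes onto the block faces), then
decimate `b² = 4` plaquettes in series (four-fold convolution). [Migdal 1975; Kadanoff 1976; Tomboulis 2007 (2.8)–(2.12), `ζ = b²`] -/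
def mkStep (w : G → ℝ) : G → ℝ :=
  fun U => haarConvPow (fun V => w V ^ 4) 3 U / haarConvPow (fun V => w V ^ 4) 3 1

/-- `n` MK steps applied to the weight normalised by its value at `1`. -/
def mkIter : ℕ → (G → ℝ) → G → ℝ
  | 0, w => fun U => w U / w 1
  | n + 1, w => mkStep (mkIter n w)

/-- ONE **non-uniformly tuned** potential-moving step (`b = 2`, `d = 4`, `r = 1`), normalised at the identity: of the four in-plane
tiles of a coarse plaquette, two receive the moved strength `4 + ε` and two `4 − ε` (translation-average still `β` per plaquette, so
Jensen∕convexity of `ln Z` gives the SAME upper-bound property as MK — Kadanoff's variational bond moving [Kadanoff 1975 PRL 34, 1005;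
Tomboulis 2007 App. A]); then the four tiles are decimated in series.  At tree level `1/β' = Σᵢ 1/(ζᵢβ)`, so the pattern
`(4+ε,4+ε,4−ε,4−ε)` LOWERS the coarse coupling by the factor `1 − ε²/16`: a classical speed-up `ε²β/16` per octave.  `ε = 0` is `mkStep`. -/
def tunedStep (ε : ℝ) (w : G → ℝ) : G → ℝ :=
  fun U => haarConv (haarConvPow (fun V => w V ^ ((4 : ℝ) + ε)) 1) (haarConvPow (fun V => w V ^ ((4 : ℝ) - ε)) 1) U /
    haarConv (haarConvPow (fun V => w V ^ ((4 : ℝ) + ε)) 1) (haarConvPow (fun V => w V ^ ((4 : ℝ) - ε)) 1) 1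

/-- The **two-loop tuning schedule** `ε_n² = κ₁/β_n − κ₂/β_n²` along the nominal trajectory `β_n = β − n/4` (MK's exact one-loop
decrement for `b = 2` is `1/4` per octave), clipped to `[0,1]` and switched off once `β_n ≤ max 1 (κ₂/κ₁)`: `κ₁ = 16·(8b₀ln2 − 1/4)`
cancels MK's one-loop velocity deficit (`R(2) = 0.9708`), `κ₂` the two-loop mismatch; the remainder is summable, so the lag is BOUNDED. -/
def tuneEps (κ₁ κ₂ β : ℝ) (n : ℕ) : ℝ :=
  min 1 (Real.sqrt (max 0 (κ₁ / max 1 (β - n / 4) - κ₂ / (max 1 (β - n / 4)) ^ 2)))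

/-- `n` tuned steps (schedule `tuneEps κ₁ κ₂ β`) applied to the weight normalised by its value at `1`. -/
def tunedIter (κ₁ κ₂ β : ℝ) : ℕ → (G → ℝ) → G → ℝ
  | 0, w => fun U => w U / w 1
  | n + 1, w => tunedStep (tuneEps κ₁ κ₂ β n) (tunedIter κ₁ κ₂ β n w)

/-- The temporally twisted partition function of the box `n₀ × n₁ × n₂ × n₃` for a GENERAL plaquette weight `w` (twist
`z = (z 0, z 1, z 2)` on 't Hooft's coclosed stacks, `tHooftTwistFactor`): VERBATIM `wilsonFinTorusTwistedPartition` with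
`exp (−β (N − Re tr ρ ·))` replaced by `w`. -/
def weightedTwistedZ (w : G → ℝ) (z : Fin 4 → G) (n₀ n₁ n₂ n₃ : ℕ) : ℝ :=
  ∫ U, ∏ x : FinTorusSite n₀ n₁ n₂ n₃, ∏ q : {q : Fin 4 × Fin 4 // q.1 < q.2},
      w (tHooftTwistFactor z x q.1.1 q.1.2 * finTorusPlaquette U x q.1.1 q.1.2)
    ∂(Measure.pi fun _ : FinTorusSite n₀ n₁ n₂ n₃ × Fin 4 => haarProbability G)

/-- Twist cost `1 − Z_w⁽ᶻ⁾/Z_w` of the cold box `L³ × t` for the general weight `w`. -/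
def twistCostW (w : G → ℝ) (z : Fin 4 → G) (L t : ℕ) : ℝ :=
  1 - weightedTwistedZ w z L L L t / weightedTwistedZ w 1 L L L t

/-- Twist cost `1 − Z⁽ᶻ⁾/Z` of the cold box `L³ × t` for the Wilson action at coupling `β` (the tree's partition functions). -/
def twistCost {N : ℕ} (ρ : G →* Matrix (Fin N) (Fin N) ℂ) (β : ℝ) (z : Fin 4 → G) (L t : ℕ) : ℝ :=
  1 - wilsonFinTorusTwistedPartition ρ β z L L L t / wilsonFinTorusPartition ρ β L L L t

end Defs

/-! ## §1 The slot token PXcof(1∕24), spelled out, and the four obligations (OPEN — nothing claimed) -/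

/-- **PXcof(1∕24)** — VERBATIM the body of the 26930 slot's `PinnedCofinalBill.PinnedExitsCofinalAt (1/24)`
(`Cruxes/IRcof/Lines/pinned_cofinal_bill.lean` §1; that workfile is not an importable build target, so the token is spelled out here —
the two agree by `Iff.rfl`) = the conclusion of the landed `PinnedExitCofinal.pinnedExitsCofinal_of_pinnedExitAt` at `θ = 1/24`. -/
def PXcof24 : Prop :=
  ∀ (G : Type) [Group G] [TopologicalSpace G] [IsTopologicalGroup G] [CompactSpace G],
    IsCompactSimpleLieGroup G → SimplyConnectedSpace G →
    letI : MeasurableSpace G := borel G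
    haveI : BorelSpace G := ⟨rfl⟩
    ∀ (r : LatticeRep G) (a : ℝ → ℝ), (∀ β, 0 < a β) → Tendsto a atTop (𝓝 0) → LowerBounds G r a →
      ∃ T : ℝ, ∀ β₁ : ℝ, ∃ β : ℝ, β₁ ≤ β ∧ ∃ L : ℕ, 8 ≤ L ∧ a β * (L : ℝ) ≤ T ∧ coldDefect r.ρ β L ≤ (1 / 24 : ℝ)


/-- **S_sc (support) — strong-coupling twist bound for a general near-trivial weight on the coarse cold boxes.**  A continuous
plaquette weight within `10⁻³` of `1` in sup norm has temporal-twist cost `≤ 1/96` on `8³ × 2` and `8³ × 4` for every central twist.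
Polymer expansion: only clusters containing a surface wrapping a temporal `(μ,3)` 2-torus (`≥ 16` plaquettes) feel a central twist
['t Hooft 1979 §2; Münster 1981; Ito–Seiler arXiv:0803.3019 Thm 2.2 (1)]; activity `2·10⁻³` is deep inside the Kotecký–Preiss
radius in `d = 4`.  Why it might fail: only by a misstated constant (the margin is `> 10³⁰`). -/
def SCTwistBound : Prop :=
  ∀ (G : Type) [Group G] [TopologicalSpace G] [IsTopologicalGroup G] [CompactSpace G] [MeasurableSpace G] [BorelSpace G],
    ∀ w : G → ℝ, Continuous w → (∀ U : G, |w U - 1| ≤ 1 / 1000) →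
      ∀ z : Fin 4 → G, (∀ μ, z μ ∈ Subgroup.center G) → ∀ t : ℕ, (t = 2 ∨ t = 4) →
        twistCostW w z 8 t ≤ 1 / 96

/-- **K_tuned (crux, rank 2 — the sandwich for SOME two-loop-tuned non-uniform potential-moving chain).**  For simply-connected
compact simple `G`, under the crux's hypotheses on the unit map `a`, there is a schedule `(κ₁, κ₂)` (class: `tuneEps`, `0 ≤ ε_n ≤ 1`),
a floor multiple `S_K`, a lag `k₀` and a threshold `β_K` such that for every `β ≥ β_K` and level `n`:
(MINORANT, beyond the floor scale — femto fine boxes excluded) if `S_K ≤ a(β)·8·2ⁿ` then for every central temporal twist and `t ∈ {2,4}`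
the Wilson twist cost on `(8·2ⁿ)³ × (t·2ⁿ)` is at most the twist cost of the `n`-fold tuned-decimated weight on `8³ × t`; and
(BOUNDED LAG) if `2^{k₀} ≤ a(β)·2ⁿ` the tuned weight is continuous and within `10⁻³` of `1` (inside the PROVED double-exponential SC basin
of the `r = 1` recursion, Tomboulis 2007 App. D: `‖g‖ < e^{−5.85} ≈ 2.9·10⁻³`).  LINE 1 (`mk_lag_sandwich`, `ε ≡ 0`) is the case
`κ₁ = 0`, whose lag half is guidance-FALSE (`R(2) = π²(1−b⁻²)/(11 ln b) = 0.9708 < 1`: lag `0.106 β_W` octaves, §K MK-VELOCITY WALL);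
here the one-loop deficit is cancelled by the classical speed-up `ε²β/16` (`κ₁ = 16(8b₀ln2 − 1/4) = 88 ln2/(3π²)·… = 0.1203` for SU(2);
numerically `+0.0060`/octave at `κ₁ = 0.109`, predicted `0.0068`) and the two-loop log-drift by `κ₂`.  VELOCITY PINCER (this line's
barrier note): the minorant half forces `R ≤ 1` asymptotically, the lag half `R ≥ 1`, so ONLY schedules with exact one- AND two-loop
velocity can serve — a two-parameter tuning condition, not a wall.  Why it might fail: (i) the minorant direction is no longer protected
by a velocity margin (only by the bounded positive offset and the deep-IR rate comparison `S_SC ≫ √(C/c)`), and a Jensen-upper scheme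
CAN under-order the twist (temporal-only moving does); (ii) the sign of the untuned three-loop remainder decides lag vs bounded LEAD;
(iii) `U(1)₄` analogue false (restricted to simple s.c. `G`).  [arXiv:0707.2179 §5, App. A, D; Kadanoff 1975; arXiv:0711.4930 §3;
arXiv:0803.3019 Problems 1–3; this line's card T2] -/
def TunedSandwich : Prop :=
  ∀ (G : Type) [Group G] [TopologicalSpace G] [IsTopologicalGroup G] [CompactSpace G],
    IsCompactSimpleLieGroup G → SimplyConnectedSpace G →
    letI : MeasurableSpace G := borel G
    haveI : BorelSpace G := ⟨rfl⟩
    ∀ (r : LatticeRep G) (a : ℝ → ℝ), (∀ β, 0 < a β) → Tendsto a atTop (𝓝 0) → LowerBounds G r a →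
      ∃ (κ₁ κ₂ SK βK : ℝ) (k₀ : ℕ), ∀ β : ℝ, βK ≤ β → ∀ n : ℕ,
        (SK ≤ a β * (8 * (2 : ℝ) ^ n) →
          ∀ z : Fin 4 → G, (∀ μ, z μ ∈ Subgroup.center G) → ∀ t : ℕ, (t = 2 ∨ t = 4) →
            twistCost r.ρ β z (8 * 2 ^ n) (t * 2 ^ n) ≤
              twistCostW (tunedIter κ₁ κ₂ β n (wilsonPlaqWeight r.ρ β)) z 8 t) ∧
        ((2 : ℝ) ^ k₀ ≤ a β * 2 ^ n →
          Continuous (tunedIter κ₁ κ₂ β n (wilsonPlaqWeight r.ρ β)) ∧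
            ∀ U : G, |tunedIter κ₁ κ₂ β n (wilsonPlaqWeight r.ρ β) U - 1| ≤ 1 / 1000)

/-- **V (residual, E-adjacent) — vacuum-sector purity on the pinned corridor.**  Under the crux's hypotheses there is `S > 0` such
that for every pin `T`, beyond `β_V(T)`, EVERY cold `4:1` box with `S ≤ a(β)·L ≤ T` has, for some finite set `s ∋ 1` of central
temporal twists (intended: all of `Z(G)³`, projecting the thermal trace onto the zero-electric-flux sector), projected period-doubling
defect `≤ 1/96`.  This is the `0⁺⁺`-gap-and-unique-vacuum half of purity, which NO twist ∕ vortex observable sees and MK cannot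
supply; `E ⇒ V` at each box (`s = {1}`).  FALSE for `U(1)₄` (photon gas in the flux-free sector).  Why it might fail for `SU(N)`:
it is summit-adjacent (row 21's V, here on all corridor boxes rather than at one box of V's choosing, because the MK-certified box
`8·2ⁿ` is located only up to the corridor). ['t Hooft 1979; Lüscher 1982; row 21 `VacuumSectorPuritySC`] -/
def VacuumPurityCorridor : Prop :=
  ∀ (G : Type) [Group G] [TopologicalSpace G] [IsTopologicalGroup G] [CompactSpace G],
    IsCompactSimpleLieGroup G → SimplyConnectedSpace G →
    letI : MeasurableSpace G := borel G
    haveI : BorelSpace G := ⟨rfl⟩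
    ∀ (r : LatticeRep G) (a : ℝ → ℝ), (∀ β, 0 < a β) → Tendsto a atTop (𝓝 0) → LowerBounds G r a →
      ∃ S : ℝ, 0 < S ∧ ∀ T : ℝ, ∃ βV : ℝ, ∀ β : ℝ, βV ≤ β → ∀ L : ℕ, 8 ≤ L →
        S ≤ a β * (L : ℝ) → a β * (L : ℝ) ≤ T →
          ∃ s : Finset (Fin 4 → G), (1 : Fin 4 → G) ∈ s ∧ (∀ z ∈ s, ∀ μ, z μ ∈ Subgroup.center G) ∧
            1 - (s.card : ℝ) * (∑ z ∈ s, wilsonFinTorusTwistedPartition r.ρ β z L L L (2 * (L / 4))) /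
                (∑ z ∈ s, wilsonFinTorusTwistedPartition r.ρ β z L L L (L / 4)) ^ 2 ≤ 1 / 96

/-! ## §2 Row 21's seam, re-spelled over `wilsonFinTorusTwistedPartition` (PROVED; DEDUP: idea-10 `flux_purity_split.lean` §2) -/

/-- **The arithmetic of the cut** (verbatim row 21).  If `S₁, S₂` are within the fraction `ε` of `n Z₁, n Z₂` and the projected
defect `1 − n S₂/S₁²` is `≤ ε`, then `1 − Z₂/Z₁² ≤ 4ε` (`ε ≤ 1/8`). -/
theorem defect_le_of_flux_vac (Z₁ Z₂ S₁ S₂ n ε : ℝ) (hn : 1 ≤ n) (hZ₁ : 0 < Z₁) (hZ₂ : 0 < Z₂)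
    (hε0 : 0 ≤ ε) (hε : ε ≤ 1 / 8)
    (ha : |S₁ - n * Z₁| ≤ ε * (n * Z₁)) (hb : |S₂ - n * Z₂| ≤ ε * (n * Z₂))
    (hc : 1 - n * S₂ / S₁ ^ 2 ≤ ε) : 1 - Z₂ / Z₁ ^ 2 ≤ 4 * ε := by
  have hn0 : 0 < n := lt_of_lt_of_le one_pos hn
  have hnZ₁ : 0 < n * Z₁ := mul_pos hn0 hZ₁
  have hnZ₂ : 0 < n * Z₂ := mul_pos hn0 hZ₂
  have hS₁ : (1 - ε) * (n * Z₁) ≤ S₁ := by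
    have := (abs_sub_le_iff.1 ha).2
    nlinarith
  have h1ε : 0 < 1 - ε := by linarith
  have hS₁pos : 0 < S₁ := lt_of_lt_of_le (mul_pos h1ε hnZ₁) hS₁
  have hS₂ : S₂ ≤ (1 + ε) * (n * Z₂) := by
    have := (abs_sub_le_iff.1 hb).1
    nlinarith
  have hS₁sq : 0 < S₁ ^ 2 := by positivity
  have hc' : (1 - ε) * S₁ ^ 2 ≤ n * S₂ := by
    have h1 : 1 - ε ≤ n * S₂ / S₁ ^ 2 := by linarith
    exact (le_div_iff₀ hS₁sq).1 h1
  have h3 : (1 - ε) ^ 2 * (n * Z₁) ^ 2 ≤ S₁ ^ 2 := by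
    have h0 : 0 ≤ (1 - ε) * (n * Z₁) := le_of_lt (mul_pos h1ε hnZ₁)
    have := pow_le_pow_left₀ h0 hS₁ 2
    simpa [mul_pow] using this
  have h4 : (1 - ε) ^ 3 * (n * Z₁) ^ 2 ≤ n * S₂ := by
    have := mul_le_mul_of_nonneg_left h3 (le_of_lt h1ε)
    nlinarith
  have h5 : n * S₂ ≤ (1 + ε) * n * (n * Z₂) := by nlinarith
  have h6 : (1 - ε) ^ 3 * Z₁ ^ 2 ≤ (1 + ε) * Z₂ := by
    have h45 : (1 - ε) ^ 3 * (n * Z₁) ^ 2 ≤ (1 + ε) * n * (n * Z₂) := le_trans h4 h5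
    have hn2 : 0 < n ^ 2 := by positivity
    have : (1 - ε) ^ 3 * Z₁ ^ 2 * n ^ 2 ≤ (1 + ε) * Z₂ * n ^ 2 := by nlinarith
    exact le_of_mul_le_mul_right this hn2
  have h7 : (1 - 4 * ε) * (1 + ε) ≤ (1 - ε) ^ 3 := by
    have h : 0 ≤ ε ^ 2 * (7 - ε) := mul_nonneg (sq_nonneg ε) (by linarith)
    nlinarith [h]
  have hZ₁sq : 0 < Z₁ ^ 2 := by positivity
  have h8 : (1 - 4 * ε) * Z₁ ^ 2 ≤ Z₂ := by
    have h1e : 0 < 1 + ε := by linarith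
    have : (1 - 4 * ε) * (1 + ε) * Z₁ ^ 2 ≤ (1 + ε) * Z₂ := by nlinarith
    nlinarith
  have h9 : 1 - 4 * ε ≤ Z₂ / Z₁ ^ 2 := by
    rw [le_div_iff₀ hZ₁sq]
    exact h8
  linarith

section Seams

variable {G : Type} [Group G] [TopologicalSpace G] [IsTopologicalGroup G] [CompactSpace G]
  [MeasurableSpace G] [BorelSpace G]

/-- **`F ∧ V ⇒ E` at one `(G, r, β, L)`** over a twist set `s` (row 21's `coldDefect_le_of_flux_vac`, with the twisted partition
function spelled `wilsonFinTorusTwistedPartition r.ρ β z L L L t`). -/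
theorem coldDefect_le_of_flux_vac_tw (r : LatticeRep G) (β : ℝ) (L : ℕ) {ε : ℝ} (hε0 : 0 ≤ ε) (hε : ε ≤ 1 / 8)
    (s : Finset (Fin 4 → G)) (h1 : (1 : Fin 4 → G) ∈ s)
    (hF : ∀ z ∈ s, ∀ t : ℕ, (t = L / 4 ∨ t = 2 * (L / 4)) →
      |wilsonFinTorusTwistedPartition r.ρ β z L L L t - wilsonFinTorusPartition r.ρ β L L L t| ≤
        ε * wilsonFinTorusPartition r.ρ β L L L t)
    (hV : 1 - (s.card : ℝ) * (∑ z ∈ s, wilsonFinTorusTwistedPartition r.ρ β z L L L (2 * (L / 4))) /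
              (∑ z ∈ s, wilsonFinTorusTwistedPartition r.ρ β z L L L (L / 4)) ^ 2 ≤ ε) :
    coldDefect r.ρ β L ≤ 4 * ε := by
  haveI : SecondCountableTopology G :=
    (r.continuous.isClosedEmbedding r.injective).isEmbedding.secondCountableTopology
  set Z₁ := wilsonFinTorusPartition r.ρ β L L L (L / 4) with hZ₁def
  set Z₂ := wilsonFinTorusPartition r.ρ β L L L (2 * (L / 4)) with hZ₂def
  have hZ₁ : 0 < Z₁ := wilsonFinTorusPartition_pos r.continuous β L L L (L / 4)
  have hZ₂ : 0 < Z₂ := wilsonFinTorusPartition_pos r.continuous β L L L (2 * (L / 4))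
  have hn : (1 : ℝ) ≤ (s.card : ℝ) := by
    exact_mod_cast Finset.card_pos.2 ⟨1, h1⟩
  have hsum : ∀ t : ℕ, (t = L / 4 ∨ t = 2 * (L / 4)) →
      |∑ z ∈ s, wilsonFinTorusTwistedPartition r.ρ β z L L L t - (s.card : ℝ) * wilsonFinTorusPartition r.ρ β L L L t| ≤
        ε * ((s.card : ℝ) * wilsonFinTorusPartition r.ρ β L L L t) := by
    intro t ht
    have hrw : ∑ z ∈ s, wilsonFinTorusTwistedPartition r.ρ β z L L L t -
        (s.card : ℝ) * wilsonFinTorusPartition r.ρ β L L L t =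
        ∑ z ∈ s, (wilsonFinTorusTwistedPartition r.ρ β z L L L t - wilsonFinTorusPartition r.ρ β L L L t) := by
      rw [Finset.sum_sub_distrib, Finset.sum_const, nsmul_eq_mul]
    rw [hrw]
    calc |∑ z ∈ s, (wilsonFinTorusTwistedPartition r.ρ β z L L L t - wilsonFinTorusPartition r.ρ β L L L t)|
        ≤ ∑ z ∈ s, |wilsonFinTorusTwistedPartition r.ρ β z L L L t - wilsonFinTorusPartition r.ρ β L L L t| :=
          Finset.abs_sum_le_sum_abs _ _
      _ ≤ ∑ z ∈ s, ε * wilsonFinTorusPartition r.ρ β L L L t := Finset.sum_le_sum fun z hz => hF z hz t ht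
      _ = ε * ((s.card : ℝ) * wilsonFinTorusPartition r.ρ β L L L t) := by
          rw [Finset.sum_const, nsmul_eq_mul]; ring
  have ha := hsum (L / 4) (Or.inl rfl)
  have hb := hsum (2 * (L / 4)) (Or.inr rfl)
  show 1 - Z₂ / Z₁ ^ 2 ≤ 4 * ε
  exact defect_le_of_flux_vac Z₁ Z₂ _ _ (s.card : ℝ) ε hn hZ₁ hZ₂ hε0 hε ha hb hV

/-- **Twist cost `≤ ε` plus reflection positivity give the two-sided flux bound F at one box** (`t ≥ 2`, `β ≥ 0`, central `z`):
`|Z⁽ᶻ⁾ − Z| ≤ ε·Z`.  Upper side: the landed `TwistCost.twistedPartition_le` (`Z⁽ᶻ⁾ ≤ Z`). -/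
theorem abs_twisted_sub_le_of_twistCost (r : LatticeRep G) {β : ℝ} (hβ : 0 ≤ β) (L m : ℕ) {z : Fin 4 → G}
    (hz : ∀ μ, z μ ∈ Subgroup.center G) {ε : ℝ}
    (hc : twistCost r.ρ β z L (m + 2) ≤ ε) :
    |wilsonFinTorusTwistedPartition r.ρ β z L L L (m + 2) - wilsonFinTorusPartition r.ρ β L L L (m + 2)| ≤
      ε * wilsonFinTorusPartition r.ρ β L L L (m + 2) := by
  haveI : SecondCountableTopology G :=
    (r.continuous.isClosedEmbedding r.injective).isEmbedding.secondCountableTopology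
  have hZ : 0 < wilsonFinTorusPartition r.ρ β L L L (m + 2) := wilsonFinTorusPartition_pos r.continuous β L L L (m + 2)
  have hup : wilsonFinTorusTwistedPartition r.ρ β z L L L (m + 2) ≤ wilsonFinTorusPartition r.ρ β L L L (m + 2) :=
    twistedPartition_le r.continuous r.mem_unitary hβ L L L m hz
  have hlow : (1 - ε) * wilsonFinTorusPartition r.ρ β L L L (m + 2) ≤
      wilsonFinTorusTwistedPartition r.ρ β z L L L (m + 2) := by
    unfold twistCost at hc
    have h1 : 1 - ε ≤ wilsonFinTorusTwistedPartition r.ρ β z L L L (m + 2) /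
        wilsonFinTorusPartition r.ρ β L L L (m + 2) := by linarith
    exact (le_div_iff₀ hZ).1 h1
  rw [abs_sub_le_iff]
  constructor
  · nlinarith
  · nlinarith

end Seams

/-! ## §3 The stubs (ALL the content) -/

/-- S_sc — support (strong-coupling polymer expansion; theorem-grade, M). -/
theorem stub_scTwistBound : SCTwistBound := by
  sorry

/-- K_tuned — crux, rank 2 (minorant ∧ bounded lag for SOME two-loop-tuned non-uniform MK chain; XL). -/
theorem stub_tunedSandwich : TunedSandwich := by
  sorry

/-- V — residual (vacuum-sector purity on the pinned corridor; E-adjacent, XL). -/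
theorem stub_vacuumPurityCorridor : VacuumPurityCorridor := by
  sorry

/-! ## §4 The composition (PROVED): K_tuned ∧ S_sc ∧ V ⇒ PX(1∕24) ⇒ PXcof(1∕24) ⇒ (with N_cof) IRcof -/

/-- A real number is dominated by `a · 2ⁿ` for some `n` (`a > 0`). -/
theorem exists_le_mul_two_pow {M c : ℝ} (hc : 0 < c) : ∃ n : ℕ, M ≤ c * 2 ^ n := by
  obtain ⟨m, hm⟩ := exists_nat_gt (M / c)
  refine ⟨m, ?_⟩
  have h2 : (m : ℝ) ≤ (2 : ℝ) ^ m := by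
    have h := Nat.lt_two_pow_self (n := m)
    exact_mod_cast h.le
  have h3 : M / c ≤ 2 ^ m := le_trans hm.le h2
  rw [div_le_iff₀ hc] at h3
  linarith [h3]

/-- **THE BILL OF THIS LINE, 19354 currency**: K_tuned ∧ S_sc ∧ V ⇒ `PinnedExit96.PinnedExitAt (1/24)` (token PX, literally). -/
theorem pinnedExitAt_of (hS : SCTwistBound) (hT : TunedSandwich) (hV : VacuumPurityCorridor) :
    PinnedExitAt (1 / 24) := by
  intro G _ _ _ _ hG hsc
  letI : MeasurableSpace G := borel G
  haveI : BorelSpace G := ⟨rfl⟩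
  intro r a ha ha0 hlb
  obtain ⟨κ₁, κ₂, SK, βK, k₀, hT'⟩ := hT G hG hsc r a ha ha0 hlb
  obtain ⟨S, hS0, hVT⟩ := hV G hG hsc r a ha ha0 hlb
  set M₀ : ℝ := max (max ((2 : ℝ) ^ k₀) (S / 8)) (SK / 8) with hM₀def
  have h2k : (0 : ℝ) < (2 : ℝ) ^ k₀ := by positivity
  have hM₀ : 0 < M₀ := lt_of_lt_of_le h2k (le_trans (le_max_left _ _) (le_max_left _ _))
  obtain ⟨βV, hVβ⟩ := hVT (16 * M₀)
  obtain ⟨βa, hβa⟩ := eventually_atTop.1 (ha0.eventually (gt_mem_nhds hM₀))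
  refine ⟨16 * M₀, max (max βK βV) (max βa 0), fun β hβ => ?_⟩
  have hβ' : max (max βK βV) (max βa 0) ≤ β := hβ
  have hβK : βK ≤ β := le_trans (le_trans (le_max_left _ _) (le_max_left _ _)) hβ'
  have hβV : βV ≤ β := le_trans (le_trans (le_max_right _ _) (le_max_left _ _)) hβ'
  have hβa' : βa ≤ β := le_trans (le_trans (le_max_left _ _) (le_max_right _ _)) hβ'
  have hβ0 : 0 ≤ β := le_trans (le_trans (le_max_right _ _) (le_max_right _ _)) hβ'
  have haM : a β < M₀ := hβa β hβa'
  -- the MK level: the least `n` with `M₀ ≤ a β · 2ⁿ`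
  classical
  have hex : ∃ n : ℕ, M₀ ≤ a β * 2 ^ n := exists_le_mul_two_pow (ha β)
  obtain ⟨n, hn, hnmin⟩ : ∃ n : ℕ, M₀ ≤ a β * 2 ^ n ∧ ∀ m : ℕ, m < n → ¬ M₀ ≤ a β * 2 ^ m :=
    ⟨Nat.find hex, Nat.find_spec hex, fun m hm => Nat.find_min hex hm⟩
  have hup : a β * 2 ^ n ≤ 2 * M₀ := by
    rcases Nat.eq_zero_or_pos n with h0 | hpos
    · subst h0
      simp only [pow_zero, mul_one]
      linarith
    · have hlt := hnmin (n - 1) (by omega)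
      push Not at hlt
      have h2n : (2 : ℝ) ^ n = 2 * 2 ^ (n - 1) := by
        rw [← pow_succ']
        congr 1
        omega
      rw [h2n]
      nlinarith [ha β]
  have hk₀ : (2 : ℝ) ^ k₀ ≤ a β * 2 ^ n := le_trans (le_trans (le_max_left _ _) (le_max_left _ _)) hn
  have hS8 : S / 8 ≤ a β * 2 ^ n := le_trans (le_trans (le_max_right _ _) (le_max_left _ _)) hn
  have hSK8 : SK / 8 ≤ a β * 2 ^ n := le_trans (le_max_right _ _) hn
  have hSK : SK ≤ a β * (8 * (2 : ℝ) ^ n) := by nlinarith [ha β]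
  -- the box
  refine ⟨8 * 2 ^ n, ?_, ?_, ?_⟩
  · have h1 : 1 ≤ 2 ^ n := Nat.one_le_two_pow
    omega
  · have hcast : ((8 * 2 ^ n : ℕ) : ℝ) = 8 * (2 : ℝ) ^ n := by push_cast; ring
    rw [hcast]
    nlinarith [ha β]
  · -- purity from F (= K_tuned: minorant + lag, S_sc, RP) and V via the seam at ε = 1/96
    have hL4 : 8 * 2 ^ n / 4 = 2 * 2 ^ n := by omega
    have hcast : ((8 * 2 ^ n : ℕ) : ℝ) = 8 * (2 : ℝ) ^ n := by push_cast; ring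
    have hSL : S ≤ a β * ((8 * 2 ^ n : ℕ) : ℝ) := by rw [hcast]; nlinarith [ha β]
    have hLT : a β * ((8 * 2 ^ n : ℕ) : ℝ) ≤ 16 * M₀ := by rw [hcast]; nlinarith [ha β]
    have hL8 : 8 ≤ 8 * 2 ^ n := by have h1 : 1 ≤ 2 ^ n := Nat.one_le_two_pow; omega
    obtain ⟨s, h1s, hcen, hVs⟩ := hVβ β hβV (8 * 2 ^ n) hL8 hSL hLT
    have hmk := (hT' β hβK n).2 hk₀
    have hpure := coldDefect_le_of_flux_vac_tw r β (8 * 2 ^ n) (ε := 1 / 96) (by norm_num) (by norm_num) s h1s ?_ hVs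
    · linarith
    · intro z hz t ht
      have hzc := hcen z hz
      rw [hL4] at ht
      -- `t = t₀ · 2ⁿ` with `t₀ ∈ {2, 4}`; write `t = m + 2`
      obtain ⟨t₀, ht₀, rfl⟩ : ∃ t₀ : ℕ, (t₀ = 2 ∨ t₀ = 4) ∧ t = t₀ * 2 ^ n := by
        rcases ht with h | h
        · exact ⟨2, Or.inl rfl, by rw [h]⟩
        · exact ⟨4, Or.inr rfl, by rw [h]; ring⟩
      have hmin' := (hT' β hβK n).1 hSK z hzc t₀ ht₀
      have hsc' := hS G (tunedIter κ₁ κ₂ β n (wilsonPlaqWeight r.ρ β)) hmk.1 hmk.2 z hzc t₀ ht₀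
      have hcost : twistCost r.ρ β z (8 * 2 ^ n) (t₀ * 2 ^ n) ≤ 1 / 96 := le_trans hmin' hsc'
      obtain ⟨m, hm⟩ : ∃ m : ℕ, t₀ * 2 ^ n = m + 2 := by
        have h1 : 1 ≤ 2 ^ n := Nat.one_le_two_pow
        have h2 : 2 ≤ t₀ := by rcases ht₀ with h | h <;> omega
        have h3 : 2 ≤ t₀ * 2 ^ n := by
          have := Nat.mul_le_mul h2 h1
          simpa using this
        exact ⟨t₀ * 2 ^ n - 2, (Nat.sub_add_cancel h3).symm⟩
      rw [hm] at hcost ⊢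
      exact abs_twisted_sub_le_of_twistCost r hβ0 (8 * 2 ^ n) m hzc hcost

/-- **26930 currency**: the same three obligations give the slot token `PinnedCofinalBill.PinnedExitsCofinalAt (1/24)` (PXcof,
literally), through the landed `PinnedExitCofinal.pinnedExitsCofinal_of_pinnedExitAt` (PX ⇒ PXcof). -/
theorem pxcof24_of (hS : SCTwistBound) (hT : TunedSandwich) (hV : VacuumPurityCorridor) : PXcof24 :=
  pinnedExitsCofinal_of_pinnedExitAt (pinnedExitAt_of hS hT hV)

/-- **With the slot's residual N_cof, the crux BY NAME**: K_tuned ∧ S_sc ∧ V ∧ `IRnscCof` ⇒ `Theses.BalabanLadder.IRcof`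
(the slot's 8-line composition `PinnedCofinalBill.IRcof_of` over the landed X-free cofinal kernel, repeated verbatim). -/
theorem IRcof_of (hS : SCTwistBound) (hT : TunedSandwich) (hV : VacuumPurityCorridor)
    (hN : IRnscCof) : Summit.QuantumFields.YangMills.Theses.BalabanLadder.IRcof := by
  have hP := pxcof24_of hS hT hV
  intro G _ _ _ _ hG
  letI : MeasurableSpace G := borel G
  haveI : BorelSpace G := ⟨rfl⟩
  intro r a ha ha0 hlb
  by_cases hsc : SimplyConnectedSpace G
  · obtain ⟨T, hcof⟩ := hP G hG hsc r a ha ha0 hlb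
    exact cofinalGapOn_of_pinnedExits r a ha ha0 hcof
  · exact hN G hG hsc r a ha ha0 hlb

/-- The crux-headed compositions over the registered stubs of THIS line: token PX (19354) and token PXcof (26930); N_cof stays the slot's. -/
theorem pinnedExitAt_of_stubs : PinnedExitAt (1 / 24) :=
  pinnedExitAt_of stub_scTwistBound stub_tunedSandwich stub_vacuumPurityCorridor

theorem pxcof24_of_stubs : PXcof24 :=
  pxcof24_of stub_scTwistBound stub_tunedSandwich stub_vacuumPurityCorridor

/-! ## §5 DEDUP anchors (by-name checks that the cited tree declarations exist) -/

example := @Tomboulis2007.MKTIneq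
example := @Tomboulis2007.mkStepFun
example := @Tomboulis2007.MKFlowToStrongCoupling
example := @Literature.Barriers.QuantumFields.MigdalKadanoffGroupBlindness.not_mkConfinementCriterionU1D4
example := @Literature.Barriers.QuantumFields.MigdalKadanoff.mkIter
example := @Summit.QuantumFields.YangMills.Cruxes.IR.TwistCost.half_twist_cost_le_coldDefect

end Summit.QuantumFields.YangMills.Cruxes.IRcof.TunedMKSandwich

end
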